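import Literature.Probability.Percolation.TriLemma12
import Literature.Probability.Percolation.TriApproxDomainAssembly
import HarnessLib

/-!
# Conformal invariance of the crossing limit, reduced to Lemma 14 of Bollobás–Riordan

Topic `Literature/Probability/Percolation`; family `crit-perc`. Sibling proof file of
`CardyFormula.lean` for its named fact
`Literature.Probability.Percolation.tendsto_triDomainCrossingProb_of_crossRatio_eq` — the corollary
of Smirnov's theorem (**crit-perc.S03**, `hasCrossingLimit_triDomainCrossingProb`) that the scaling
limit, as `δ → 0⁺`, of the critical site-percolation crossing probability of a conformal rectangle on
`δ𝕋` exists and depends on the conformal rectangle only through the cross-ratio of a uniformizing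
datum (Smirnov, C. R. Acad. Sci. Paris 333 (2001), Thm. 1 and Cor.; Bollobás–Riordan,
*Percolation* (2006), Ch. 7, Thm. 2 p. 165 with p. 161). Even for `R = R'` the fact asserts the
existence of the limit, the first half of Bollobás–Riordan's Thm. 2, so it has no proof avoiding
Smirnov's theorem; `CardyFormula.lean` proves it from crit-perc.S03
(`tendsto_triDomainCrossingProb_of_crossRatio_eq_of_hasCrossingLimit`).

The tree has reduced crit-perc.S03 to the single named fact `tri_exists_discreteApprox`
(`TriApproxDomain.lean`: Lemma 14 of Bollobás–Riordan, p. 184, with the sandwich (19) — discrete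
domains approximating the conformal rectangle, for anticlockwise Carleson data):
`hasCrossingLimit_triDomainCrossingProb_of_exists_discreteApprox` (`TriLemma12.lean`) feeds the
five-fact assembly of `CardyFormulaProofs.lean` with the four discharged facts (40)
`tri_openCrossingProb_approx_sepProb_holds`, the estimates of the proof of Claim 23
`tri_sepProb_boundary_tendsto_holds` (`TriApproxDomainProofs.lean`), Claim 10
`tri_sepEvent_diff_subset_arms_holds` (`TriClaim10.lean`) and Lemma 12
`tri_sepDiffProb_rotate_holds` (`TriLemma12.lean`). This file records the same one-hypothesis
reductions for (D′) `smirnov_exists_separatingData`, for the existence of the limit in `[0, 1]`,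
and for the conformal-invariance corollary:

* `smirnov_exists_separatingData_of_exists_discreteApprox`,
* `exists_tendsto_triDomainCrossingProb_of_exists_discreteApprox`,
* `tendsto_triDomainCrossingProb_of_crossRatio_eq_of_exists_discreteApprox`.

Lemma 14 with (19) is now a theorem of the tree, `tri_exists_discreteApprox_proof`
(`TriApproxDomainAssembly.lean`: the marked inner approximations of the collar domains, the
construction-free sandwich of `TriCrossingSandwich.lean`, Claims 18–21, diagonal selection of
levels), so this file also carries the **discharges** `smirnov_exists_separatingFamilies_holds`, `hasCrossingLimit_triDomainCrossingProb_holds`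
(**crit-perc.S03, Smirnov's theorem**), `exists_tendsto_triDomainCrossingProb` and
`tendsto_triDomainCrossingProb_of_crossRatio_eq_holds` (they cannot go into
`CardyFormulaProofs.lean`, which `TriLemma12.lean` imports).

## References

* S. Smirnov, *Critical percolation in the plane: conformal invariance, Cardy's formula, scaling
  limits*, C. R. Acad. Sci. Paris Sér. I Math. 333 (2001) 239–244, Thm. 1 and Cor.; long
  version arXiv:0909.4499, Cor. 2 (p. 5).
* B. Bollobás, O. Riordan, *Percolation*, Cambridge University Press (2006), Ch. 7: p. 161
  (the cross-ratio classifies 4-marked domains), Thm. 2 p. 165, Lemma 14 p. 184 with (19),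
  §7.2.6 pp. 196–203.

## Mathlib / tree

Tree: `TriLemma12.lean` (`hasCrossingLimit_triDomainCrossingProb_of_exists_discreteApprox`,
`tri_sepDiffProb_rotate_holds`), `CardyFormulaProofs.lean` (`smirnov_exists_separatingData_of_facts`,
`exists_tendsto_triDomainCrossingProb_of_separatingData`), `CardyFormula.lean`
(`tendsto_triDomainCrossingProb_of_crossRatio_eq_of_hasCrossingLimit`), `TriApproxDomainAssembly.lean`
(`tri_exists_discreteApprox_proof`), `SmirnovSeparatingData.lean`
(`smirnov_exists_separatingFamilies_of_separatingData`).
-/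

noncomputable section

open Set Filter Topology

namespace Literature.Probability.Percolation

/-- **(D′) `smirnov_exists_separatingData` from Lemma 14 alone**: the discrete separating data
of Bollobás–Riordan 2006, Ch. 7 ((9), Lemma 13, Lemma 14, proof of Claims 22–23) follow from the
discrete approximation `tri_exists_discreteApprox`, the other four inputs of
`smirnov_exists_separatingData_of_facts` being discharged ((40), the estimates of Claim 23,
Claim 10, Lemma 12). [cite: BollobasRiordan2006, Ch. 7 §7.2.6 pp. 196–203] -/
theorem smirnov_exists_separatingData_of_exists_discreteApprox (h14 : tri_exists_discreteApprox) :
    smirnov_exists_separatingData :=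
  smirnov_exists_separatingData_of_facts h14 tri_openCrossingProb_approx_sepProb_holds
    tri_sepProb_boundary_tendsto_holds tri_sepEvent_diff_subset_arms_holds tri_sepDiffProb_rotate_holds

/-- **Existence of the scaling limit of the crossing probability from Lemma 14 alone** (first half
of Bollobás–Riordan 2006, Ch. 7, Thm. 2, p. 165: "`P(D₄) = lim_{δ→0} P_δ(D₄, T)` exists"), the
limit lying in `[0, 1]`. [cite: BollobasRiordan2006, Ch. 7 Thm. 2 (p. 165)] -/
theorem exists_tendsto_triDomainCrossingProb_of_exists_discreteApprox (h14 : tri_exists_discreteApprox)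
    (R : RandomPlanarGeometry.ConformalRectangle) :
    ∃ L ∈ Icc (0 : ℝ) 1, Tendsto (triDomainCrossingProb R) (𝓝[>] 0) (𝓝 L) :=
  exists_tendsto_triDomainCrossingProb_of_separatingData
    (smirnov_exists_separatingData_of_exists_discreteApprox h14) R

/-- **Conformal invariance of the crossing limit from Lemma 14 alone**: the named fact
`tendsto_triDomainCrossingProb_of_crossRatio_eq` (Smirnov, C. R. Acad. Sci. 333 (2001), Thm. 1
and Cor.; arXiv:0909.4499, Cor. 2: "as `δ → 0`, the crossing probability tends to `h_{τ²}(x)`,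
and hence is conformally invariant"; Bollobás–Riordan 2006, Ch. 7, Thm. 2 with p. 161) follows
from the discrete approximation `tri_exists_discreteApprox` (Bollobás–Riordan Lemma 14 with
(19)): both limits are `F(η)` for the common cross-ratio `η`, by Smirnov's theorem in the form
`hasCrossingLimit_triDomainCrossingProb_of_exists_discreteApprox`.
[cite: Smirnov2001, Thm. 1 and Cor.] [cite: BollobasRiordan2006, Ch. 7 Thm. 2 (p. 165)] -/
theorem tendsto_triDomainCrossingProb_of_crossRatio_eq_of_exists_discreteApprox
    (h14 : tri_exists_discreteApprox) : tendsto_triDomainCrossingProb_of_crossRatio_eq :=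
  tendsto_triDomainCrossingProb_of_crossRatio_eq_of_hasCrossingLimit
    (hasCrossingLimit_triDomainCrossingProb_of_exists_discreteApprox h14)

/-! ### Discharges: Lemma 14 is proved (`tri_exists_discreteApprox_proof`) -/

/-- **The separating families (D) exist** — discharge of the named fact
`smirnov_exists_separatingFamilies` (`SmirnovContinuumLimit.lean`; Bollobás–Riordan 2006, Ch. 7
§7.2.6), from (D′) (`smirnov_exists_separatingFamilies_of_separatingData`; (D′) itself is discharged in
`SmirnovSeparatingDataProofs.lean`, `smirnov_exists_separatingData_holds`).
[cite: BollobasRiordan2006, Ch. 7 §7.2.6 pp. 196–203] -/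
theorem smirnov_exists_separatingFamilies_holds : smirnov_exists_separatingFamilies :=
  smirnov_exists_separatingFamilies_of_separatingData
    (smirnov_exists_separatingData_of_exists_discreteApprox tri_exists_discreteApprox_proof)

/-- **crit-perc.S03, Smirnov's theorem, holds**: discharge of the named fact
`hasCrossingLimit_triDomainCrossingProb` (`CardyFormula.lean`; Smirnov, C. R. Acad. Sci. Paris
333 (2001), Thm. 1; Bollobás–Riordan 2006, Ch. 7, Thm. 2 p. 165, proof pp. 165–203) — for every
conformal rectangle the critical site-percolation crossing probability on `δ𝕋` converges, as
`δ → 0⁺`, to Cardy's formula `F(η)` of the cross-ratio of any uniformizing datum. All of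
Bollobás–Riordan's Ch. 7 is now proved in the tree; the last input was Lemma 14 with (19)
(`tri_exists_discreteApprox_proof`), entering through
`hasCrossingLimit_triDomainCrossingProb_of_exists_discreteApprox` (`TriLemma12.lean`).
[cite: Smirnov2001, Thm. 1] [cite: BollobasRiordan2006, Ch. 7 Thm. 2 (p. 165)] -/
theorem hasCrossingLimit_triDomainCrossingProb_holds : hasCrossingLimit_triDomainCrossingProb :=
  hasCrossingLimit_triDomainCrossingProb_of_exists_discreteApprox tri_exists_discreteApprox_proof

/-- **The scaling limit of the crossing probability exists**, unconditionally (first half of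
Bollobás–Riordan 2006, Ch. 7, Thm. 2, p. 165), the limit lying in `[0, 1]`.
[cite: BollobasRiordan2006, Ch. 7 Thm. 2 (p. 165)] -/
theorem exists_tendsto_triDomainCrossingProb (R : RandomPlanarGeometry.ConformalRectangle) :
    ∃ L ∈ Icc (0 : ℝ) 1, Tendsto (triDomainCrossingProb R) (𝓝[>] 0) (𝓝 L) :=
  exists_tendsto_triDomainCrossingProb_of_exists_discreteApprox tri_exists_discreteApprox_proof R

/-- **Conformal invariance of the crossing limit holds**: discharge of the named fact
`tendsto_triDomainCrossingProb_of_crossRatio_eq` (`CardyFormula.lean`; Smirnov, C. R. Acad. Sci.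
333 (2001), Thm. 1 and Cor.: "as `δ → 0`, the crossing probability tends to `h(x)`, and hence
is conformally invariant") — two conformal rectangles with uniformizing data of equal
cross-ratio have triangular crossing probabilities converging to a common limit. From Lemma 14
(`tri_exists_discreteApprox_proof`) through
`tendsto_triDomainCrossingProb_of_crossRatio_eq_of_exists_discreteApprox`.
[cite: Smirnov2001, Thm. 1 and Cor.] [cite: BollobasRiordan2006, Ch. 7 Thm. 2 (p. 165)] -/
theorem tendsto_triDomainCrossingProb_of_crossRatio_eq_holds :
    tendsto_triDomainCrossingProb_of_crossRatio_eq :=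
  tendsto_triDomainCrossingProb_of_crossRatio_eq_of_exists_discreteApprox tri_exists_discreteApprox_proof

end Literature.Probability.Percolation

end
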